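import Summits.Ventures.PercRepro.RankLevelSetBiIndepContainNormParallel
import Summits.Ventures.PercRepro.RankLevelSetBiIndepContainNormPaving

/-! # RankLevelSetBiIndepContainNormRankThree — EVERY MATROID OF RANK ≤ 3 SATISFIES THE NORMALIZED CUMULATIVE (CX*)
(CUM-norm) (night-1 g30; dossier §42.21)

A simple matroid of rank ≤ 3 is paving (every set with fewer than `r ≤ 3` elements has at most two elements: the
empty set, a non-loop, or a non-parallel pair — **`paving_of_simple_of_eRank_le_three`**). Hence, by strong induction
on `#E`: a loop makes (CUM-norm) vacuous (`biContainNormSkew_of_loop'`), a parallel pair reduces to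
`M ／ {y} ＼ {z}` (two fewer elements, rank ≤ 3 again: an independent set of the minor becomes independent in `M`
after adding `y`; `biContainNormSkew_of_parallel'`), and a simple matroid of rank ≤ 3 is paving
(`biContainNormSkew_of_paving'`): **`biContainNormSkew_of_eRank_le_three'`** (unfolded form; rank ≤ 3 is the first
layer of the rank stratification — the census settles rank 4 completely since `2r ≥ #E` forces `#E ≤ 8`, and the
first open instances of (CUM-norm) / (CX*) are simple non-paving matroids of rank 5 on 10 elements). Every
declaration has a docstring; imports: the cell's own modules and Mathlib only. Axioms: standard. -/

namespace PercRepro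

open Set Matroid

variable {α : Type} (M : Matroid α) [M.Finite]

/-- **A simple matroid of rank ≤ 3 is paving**: every set with fewer than `r ≤ 3` elements is empty, a non-loop,
or a pair of non-parallel non-loops, hence independent. -/
lemma paving_of_simple_of_eRank_le_three (hloop : ∀ e ∈ M.E, M.Indep {e}) (hpar : ∀ y z, ¬ ParallelPair M y z)
    (hr : M.eRank ≤ 3) : Paving M := by
  intro I hI hlt
  have hIfin : I.Finite := M.ground_finite.subset hI
  have h3 : I.ncard < 3 := by
    have h := hlt.trans_le hr
    rw [← hIfin.cast_ncard_eq] at h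
    exact_mod_cast h
  rcases Nat.lt_or_ge I.ncard 1 with h0 | h1
  · have : I = ∅ := (Set.ncard_eq_zero hIfin).mp (by omega)
    rw [this]
    exact M.empty_indep
  rcases Nat.lt_or_ge I.ncard 2 with h1' | h2
  · obtain ⟨a, rfl⟩ := Set.ncard_eq_one.mp (by omega : I.ncard = 1)
    exact hloop a (hI rfl)
  · obtain ⟨a, b, hab, rfl⟩ := Set.ncard_eq_two.mp (by omega : I.ncard = 2)
    by_contra hdep
    exact hpar a b ⟨hab, Matroid.indep_singleton.mp (hloop a (hI (Set.mem_insert a _))),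
      Matroid.indep_singleton.mp (hloop b (hI (Set.mem_insert_of_mem a rfl))), hdep⟩

/-- **Every matroid of rank ≤ 3 satisfies (CUM-norm)** (unfolded form), by strong induction on `#E`. -/
theorem biContainNormSkew_of_eRank_le_three' :
    ∀ (n : ℕ) (M : Matroid α) [M.Finite], M.E.ncard = n → M.eRank ≤ 3 →
      ∀ X ⊆ M.E, ∀ i j : ℕ, i < j → i + j + 1 ≤ M.E.ncard - 2 * X.ncard →
        biContainCount M X (X.ncard + i) * (M.E.ncard - 2 * X.ncard).choose j ≤
          biContainCount M X (X.ncard + j) * (M.E.ncard - 2 * X.ncard).choose i := by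
  intro n
  induction n using Nat.strong_induction_on with
  | _ n ih =>
    intro M _ hn hr
    by_cases hloop : ∃ ℓ ∈ M.E, ¬ M.Indep {ℓ}
    · obtain ⟨ℓ, hℓE, hℓ⟩ := hloop
      exact biContainNormSkew_of_loop' M hℓE hℓ
    · push Not at hloop
      by_cases hpar : ∃ y z, ParallelPair M y z
      · obtain ⟨y, z, h⟩ := hpar
        have hn' := ncard_ground_contract_delete M h
        have hn2 := two_le_ncard_of_parallel M h
        have hr' : ((M.contract {y}).delete {z}).eRank ≤ 3 := by
          rw [Matroid.eRank_def, Matroid.eRk_le_iff]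
          intro I _ hI
          rw [indep_contract_delete_iff M h] at hI
          have h1 := hI.2.encard_le_eRank
          rw [Set.encard_insert_of_notMem hI.1.1] at h1
          exact le_self_add.trans (h1.trans hr)
        exact biContainNormSkew_of_parallel' M h (ih (n - 2) (by omega) ((M.contract {y}).delete {z}) (by rw [hn', hn]) hr')
      · push Not at hpar
        have hpav : Paving M := paving_of_simple_of_eRank_le_three M hloop hpar hr
        obtain ⟨r, hr'⟩ : ∃ r : ℕ, M.eRank = r := by
          obtain ⟨r, hr'⟩ := exists_eRk_eq_coe M M.E
          exact ⟨r, by rw [Matroid.eRank_def, hr']⟩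
        exact biContainNormSkew_of_paving' M hpav hr'

end PercRepro
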